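import Summits.Ventures.PercRepro.SixFourPLBonus
import Summits.Ventures.PercRepro.SixFourT4Generic

/-!
# PercRepro — C-025 at `(6,4)`, §22.12.4: plane TYPES — the list entries and the planes of `M` on a common footing
(p3, gen 10)

The closed form `Jlow(π)` of Theorem 22.12 sums `cost_g` and the lpp credit over the PLANE LIST `𝒫(π)` of
`SixFourPLList.lean` (`ρ`; one `Π_j` per class; `n·ν_m` copies of `{x} ∪ λ`), while the identity 22.1
(`J_four_identity`) sums them over the planes of `M`.  Both quantities depend on a plane only through its TYPE — the
number of points of its trace and its numbers of lines with `3, …, 7` points of the trace (`δ(m) = 0 = C(m,4)` for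
`m ≤ 3` and `ε(m) = 0` for `m ≤ 2`, so shorter lines never contribute).  This file sets up the types:
* `PL.ty Q`, the type of a list entry; `rhoEntry / piEntry / xlEntry` name the three kinds of entries of `planes π`
  (`planes_eq`), `Lcount_*` compute their line counts, `cost5_ty` (`cost5 g (ty Q) = cost5 g Q` for an entry with
  lines of `≤ 7` points) and the lpp credit `credit Q` of an entry (`credit_ty`; `lpp_eq` writes `lpp π` as the line
  part minus the credits of the list);
`SixFourPLTypesP.lean` defines the type `tyP M G P` of a plane of `M` and evaluates `cost5` / `credit` on it;
`SixFourPLKinds.lean` matches the planes of a plane-line set to the list entries type by type.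
-/

namespace PercRepro.SixFour

open Finset ThmH

variable {α : Type*} [DecidableEq α] {M : Matroid α} [M.Finite] {G : Finset α}

namespace PL

/-! ## Line counts of explicit lists -/

/-- The number of lines of size `m` in a list of `(size, count)` pairs. -/
def LcountL (l : List (ℕ × ℕ)) (m : ℕ) : ℕ := ((l.filter fun mc => mc.1 = m).map fun mc => mc.2).sum

/-- `Lcount` is `LcountL` on the line list. -/
theorem Lcount_eq_LcountL (Q : Pl) (m : ℕ) : Lcount Q m = LcountL Q.lines m := rfl

/-- `LcountL` on the empty list. -/
theorem LcountL_nil (m : ℕ) : LcountL [] m = 0 := rfl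

/-- `LcountL` on a cons. -/
theorem LcountL_cons (a c : ℕ) (l : List (ℕ × ℕ)) (m : ℕ) :
    LcountL ((a, c) :: l) m = (if a = m then c else 0) + LcountL l m := by
  unfold LcountL
  by_cases h : a = m
  · simp [h]
  · simp [h]

/-- `Σ_{m<8} f(m)·[a = m]·c = f(a)·c` when `a ≤ 7`; both sides vanish when `c = 0`. -/
theorem sum_range_eight_ite (f : ℕ → ℤ) (a c : ℕ) (h : c ≠ 0 → a ≤ 7) :
    ((List.range 8).map fun m => f m * (if a = m then (c : ℤ) else 0)).sum = f a * c := by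
  by_cases hc : c = 0
  · subst hc
    simp
  · have ha := h hc
    simp only [List.range_succ, List.range_zero, List.map_cons, List.map_nil, List.sum_cons, List.sum_nil,
      List.nil_append, List.cons_append]
    interval_cases a <;> simp

/-- A sum over the lines of a list with sizes `≤ 7` is a sum over the sizes `0, …, 7` weighted by the line counts. -/
theorem sum_lines_eq_sum_range (f : ℕ → ℤ) : ∀ (l : List (ℕ × ℕ)), (∀ mc ∈ l, mc.2 ≠ 0 → mc.1 ≤ 7) →
    (l.map fun mc => f mc.1 * mc.2).sum = ((List.range 8).map fun m => f m * LcountL l m).sum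
  | [], _ => by simp [LcountL_nil]
  | (a, c) :: l, h => by
    have ih := sum_lines_eq_sum_range f l (fun mc hmc => h mc (List.mem_cons_of_mem _ hmc))
    have ha : c ≠ 0 → a ≤ 7 := h (a, c) (List.mem_cons_self ..)
    simp only [List.map_cons, List.sum_cons, LcountL_cons, Nat.cast_add, Nat.cast_ite, Nat.cast_zero, mul_add,
      List.sum_map_add, ih, sum_range_eight_ite f a c ha]

/-- A list plane is SMALL if every line size occurring with a positive count is at most `7`. -/
def Small (Q : Pl) : Prop := ∀ mc ∈ Q.lines, mc.2 ≠ 0 → mc.1 ≤ 7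

/-! ## The type of a list entry -/

/-- The TYPE of a list plane: its size and its numbers of lines with `3, …, 7` points. -/
def ty (Q : Pl) : Pl := ⟨Q.q, (List.range 5).map fun i => (i + 3, Lcount Q (i + 3)), 1⟩

/-- The size of the type. -/
theorem ty_q (Q : Pl) : (ty Q).q = Q.q := rfl

/-- The type has the same line counts for `3 ≤ m ≤ 7`. -/
theorem Lcount_ty (Q : Pl) (m : ℕ) (h3 : 3 ≤ m) (h7 : m ≤ 7) : Lcount (ty Q) m = Lcount Q m := by
  unfold ty
  rw [Lcount_eq_LcountL]
  simp only [List.range_succ, List.range_zero, List.map_cons, List.map_nil, List.nil_append, List.cons_append,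
    LcountL_cons, LcountL_nil]
  interval_cases m <;> simp

/-- The line sum of the type: `Σ_{m<8} f(m)·Lcount(m)` with `f(m) = 0` for `m ≤ 2` agrees with the type's own sum. -/
theorem sum_range_ty (f : ℕ → ℤ) (hf : ∀ m ≤ 2, f m = 0) (Q : Pl) :
    ((List.range 8).map fun m => f m * LcountL (ty Q).lines m).sum =
      ((List.range 8).map fun m => f m * LcountL Q.lines m).sum := by
  have h0 := hf 0 (by norm_num)
  have h1 := hf 1 (by norm_num)
  have h2 := hf 2 (by norm_num)
  simp only [List.range_succ, List.range_zero, List.map_cons, List.map_nil, List.sum_cons, List.sum_nil,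
    List.nil_append, List.cons_append, h0, h1, h2, zero_mul, ← Lcount_eq_LcountL,
    Lcount_ty Q 3 (by norm_num) (by norm_num), Lcount_ty Q 4 (by norm_num) (by norm_num),
    Lcount_ty Q 5 (by norm_num) (by norm_num), Lcount_ty Q 6 (by norm_num) (by norm_num),
    Lcount_ty Q 7 (by norm_num) (by norm_num)]

/-- The type is small. -/
theorem Small_ty (Q : Pl) : Small (ty Q) := by
  intro mc hmc _
  unfold ty at hmc
  simp only [List.mem_map, List.mem_range] at hmc
  obtain ⟨i, hi, rfl⟩ := hmc
  dsimp only
  omega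

/-- `D₃` of a small list plane through the line counts. -/
theorem D3_eq_sum_range (Q : Pl) (hQ : Small Q) :
    D3 Q = (delta Q.q : ℤ) - ((List.range 8).map fun m => (delta m : ℤ) * LcountL Q.lines m).sum := by
  unfold D3
  rw [sum_lines_eq_sum_range (fun m => (delta m : ℤ)) Q.lines hQ]

/-- `r₃₄` of a small list plane through the line counts. -/
theorem r34_eq_sum_range (Q : Pl) (hQ : Small Q) :
    r34 Q = (ch Q.q 4 : ℤ) - ((List.range 8).map fun m => (ch m 4 : ℤ) * LcountL Q.lines m).sum := by
  unfold r34
  rw [sum_lines_eq_sum_range (fun m => (ch m 4 : ℤ)) Q.lines hQ]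

/-- `δ(m) = 0` for `m ≤ 3` (in `PL`). -/
theorem delta_le_three {m : ℕ} (hm : m ≤ 3) : delta m = 0 := by
  interval_cases m <;> decide

/-- `C(m,4) = 0` for `m ≤ 3` (in `PL`). -/
theorem ch_four_le_three {m : ℕ} (hm : m ≤ 3) : ch m 4 = 0 := by
  interval_cases m <;> decide

/-- `D₃` of the type of a small list plane is `D₃` of the plane. -/
theorem D3_ty (Q : Pl) (hQ : Small Q) : D3 (ty Q) = D3 Q := by
  rw [D3_eq_sum_range (ty Q) (Small_ty Q), D3_eq_sum_range Q hQ, ty_q,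
    sum_range_ty (fun m => (delta m : ℤ)) (fun m hm => by rw [delta_le_three (by omega)]; rfl) Q]

/-- `r₃₄` of the type of a small list plane is `r₃₄` of the plane. -/
theorem r34_ty (Q : Pl) (hQ : Small Q) : r34 (ty Q) = r34 Q := by
  rw [r34_eq_sum_range (ty Q) (Small_ty Q), r34_eq_sum_range Q hQ, ty_q,
    sum_range_ty (fun m => (ch m 4 : ℤ)) (fun m hm => by rw [ch_four_le_three (by omega)]; rfl) Q]

/-- **`cost5` depends only on the type** (small list planes). -/
theorem cost5_ty (g : ℕ) (Q : Pl) (hQ : Small Q) : cost5 g (ty Q) = cost5 g Q := by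
  unfold cost5
  rw [D3_ty Q hQ, r34_ty Q hQ, ty_q]

/-! ## The lpp credit of a list entry -/

/-- The lpp credit of a list plane: `Σ_{m=3}^{7} ε(m)·#lines(m)·C(q − m, 2)` (the plane-side term of 22.2). -/
def credit (Q : Pl) : ℤ :=
  ((List.range 5).map fun i => (eps (i + 3) : ℤ) * Lcount Q (i + 3) * ch (Q.q - (i + 3)) 2).sum

/-- The credit depends only on the type. -/
theorem credit_ty (Q : Pl) : credit (ty Q) = credit Q := by
  unfold credit
  rw [ty_q]
  refine congrArg List.sum (List.map_congr_left (fun i hi => ?_))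
  rw [List.mem_range] at hi
  rw [Lcount_ty Q (i + 3) (by omega) (by omega)]

/-- The credit is nonnegative. -/
theorem credit_nonneg (Q : Pl) : 0 ≤ credit Q := by
  unfold credit
  refine List.sum_nonneg (fun x hx => ?_)
  rw [List.mem_map] at hx
  obtain ⟨i, -, rfl⟩ := hx
  positivity

/-- A list sum of differences. -/
theorem sum_map_sub' (f g : ℕ → ℤ) : ∀ l : List ℕ, (l.map fun i => f i - g i).sum = (l.map f).sum - (l.map g).sum
  | [] => by simp
  | a :: l => by
    simp only [List.map_cons, List.sum_cons, sum_map_sub' f g l]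
    ring

/-- Exchanging two list sums. -/
theorem sum_map_sum_comm (f : ℕ → Pl → ℤ) (l₁ : List ℕ) : ∀ (l₂ : List Pl),
    (l₁.map fun i => (l₂.map fun Q => f i Q).sum).sum = (l₂.map fun Q => (l₁.map fun i => f i Q).sum).sum
  | [] => by simp
  | Q :: l₂ => by
    rw [List.map_cons, List.sum_cons, ← sum_map_sum_comm f l₁ l₂, ← List.sum_map_add]
    simp only [List.map_cons, List.sum_cons]

/-- The line part of `lpp π`: `Σ_{m=3}^{7} ε(m)·b_m(π)·C(g − m, 2)`. -/
def lineSum (π : CProf) : ℤ :=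
  ((List.range 5).map fun i => (eps (i + 3) : ℤ) * ((b π (i + 3) : ℤ) * ch (g π - (i + 3)) 2)).sum

/-- **`lpp π = lineSum π − Σ_{Q ∈ 𝒫(π)} mult(Q)·credit(Q)`**. -/
theorem lpp_eq (π : CProf) : lpp π = lineSum π - ((planes π).map fun Q => (Q.mult : ℤ) * credit Q).sum := by
  unfold lpp lineSum credit
  have h1 : ∀ i : ℕ, (eps (i + 3) : ℤ) * ((b π (i + 3) : ℤ) * ch (g π - (i + 3)) 2 -
      ((planes π).map fun P => (P.mult : ℤ) * Lcount P (i + 3) * ch (P.q - (i + 3)) 2).sum) =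
      (eps (i + 3) : ℤ) * ((b π (i + 3) : ℤ) * ch (g π - (i + 3)) 2) -
      ((planes π).map fun P => (P.mult : ℤ) * ((eps (i + 3) : ℤ) * Lcount P (i + 3) * ch (P.q - (i + 3)) 2)).sum := by
    intro i
    rw [mul_sub, ← List.sum_map_mul_left]
    congr 1
    exact congrArg List.sum (List.map_congr_left (fun P _ => by ring))
  simp only [h1, sum_map_sub']
  have hc := sum_map_sum_comm (fun i P => (P.mult : ℤ) * ((eps (i + 3) : ℤ) * Lcount P (i + 3) * ch (P.q - (i + 3)) 2))
    (List.range 5) (planes π)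
  rw [hc]
  congr 1
  exact congrArg List.sum (List.map_congr_left (fun P _ => by rw [List.sum_map_mul_left]))

/-! ## The three kinds of entries of the plane list -/

/-- The entry `ρ` of the plane list: `p` points, the line-size vector `inc₂ … inc₇`. -/
def rhoEntry (π : CProf) : Pl := ⟨π.p, (List.range 6).map fun i => (i + 2, incOf π (i + 2)), 1⟩

/-- The entry `Π_j` of the plane list for a class of size `s`: `n + s` points, the line `ℓ′` (`n + e` points), the
class (`s` points, when it is a line) and `n(s − e)` two-point lines. -/
def piEntry (π : CProf) (s : ℕ) : Pl :=
  if π.meet then ⟨π.n + s, [(π.n + 1, 1), (s, 1), (2, π.n * (s - 1))], 1⟩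
  else ⟨π.n + s, [(π.n, 1), (s, if 2 ≤ s then 1 else 0), (2, π.n * s)], 1⟩

/-- The entry `{x} ∪ λ` of the plane list for the non-class lines with `i + 2` points, with multiplicity
`n·ν_{i+2}`. -/
def xlEntry (π : CProf) (i : ℕ) : Pl :=
  ⟨i + 3, if 2 < i + 2 then [(i + 2, 1), (2, i + 2)] else [(2, 3)], π.n * nu π (i + 2)⟩

/-- `planes π` is the entry `ρ`, the entries `Π_j` over the class sizes, and the six entries `{x} ∪ λ`. -/
theorem planes_eq (π : CProf) :
    planes π = [rhoEntry π] ++ π.sizes.map (piEntry π) ++ (List.range 6).map (xlEntry π) := rfl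

/-- The size of `rhoEntry`. -/
theorem rhoEntry_q (π : CProf) : (rhoEntry π).q = π.p := rfl

/-- The multiplicity of `rhoEntry`. -/
theorem rhoEntry_mult (π : CProf) : (rhoEntry π).mult = 1 := rfl

/-- The size of `piEntry`. -/
theorem piEntry_q (π : CProf) (s : ℕ) : (piEntry π s).q = π.n + s := by
  unfold piEntry
  split_ifs <;> rfl

/-- The multiplicity of `piEntry`. -/
theorem piEntry_mult (π : CProf) (s : ℕ) : (piEntry π s).mult = 1 := by
  unfold piEntry
  split_ifs <;> rfl

/-- The size of `xlEntry`. -/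
theorem xlEntry_q (π : CProf) (i : ℕ) : (xlEntry π i).q = i + 3 := rfl

/-- The multiplicity of `xlEntry`. -/
theorem xlEntry_mult (π : CProf) (i : ℕ) : (xlEntry π i).mult = π.n * nu π (i + 2) := rfl

/-- The line counts of `rhoEntry`: `inc_m` for `2 ≤ m ≤ 7`. -/
theorem Lcount_rhoEntry (π : CProf) (m : ℕ) (h2 : 2 ≤ m) (h7 : m ≤ 7) : Lcount (rhoEntry π) m = incOf π m := by
  unfold rhoEntry
  rw [Lcount_eq_LcountL]
  simp only [List.range_succ, List.range_zero, List.map_cons, List.map_nil, List.nil_append, List.cons_append,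
    LcountL_cons, LcountL_nil]
  interval_cases m <;> simp

/-- The line counts of `piEntry` for `m ≥ 3`: `[m = n + e] + [m = s]`. -/
theorem Lcount_piEntry (π : CProf) (s m : ℕ) (h3 : 3 ≤ m) :
    Lcount (piEntry π s) m = (if m = lprime π then 1 else 0) + (if m = s then 1 else 0) := by
  unfold piEntry lprime e
  rw [Lcount_eq_LcountL]
  by_cases hmeet : π.meet = true
  · simp only [if_pos hmeet, LcountL_cons, LcountL_nil]
    split_ifs <;> omega
  · simp only [if_neg hmeet, LcountL_cons, LcountL_nil]
    split_ifs <;> omega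

/-- The line counts of `xlEntry` for `m ≥ 3`: `[m = i + 2]`. -/
theorem Lcount_xlEntry (π : CProf) (i m : ℕ) (h3 : 3 ≤ m) :
    Lcount (xlEntry π i) m = if m = i + 2 then 1 else 0 := by
  unfold xlEntry
  rw [Lcount_eq_LcountL]
  by_cases hi : 2 < i + 2
  · simp only [if_pos hi, LcountL_cons, LcountL_nil]
    split_ifs <;> omega
  · simp only [if_neg hi, LcountL_cons, LcountL_nil]
    split_ifs <;> omega

/-- `rhoEntry` is small. -/
theorem Small_rhoEntry (π : CProf) : Small (rhoEntry π) := by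
  intro mc hmc _
  unfold rhoEntry at hmc
  simp only [List.mem_map, List.mem_range] at hmc
  obtain ⟨i, hi, rfl⟩ := hmc
  dsimp only
  omega

/-- `piEntry` is small when `n + e ≤ 7` and `s ≤ 7`. -/
theorem Small_piEntry (π : CProf) (s : ℕ) (hn : π.n + e π ≤ 7) (hs : s ≤ 7) : Small (piEntry π s) := by
  intro mc hmc _
  unfold piEntry at hmc
  unfold e at hn
  by_cases hmeet : π.meet = true
  · rw [if_pos hmeet] at hmc hn
    simp only [List.mem_cons, List.not_mem_nil, or_false] at hmc
    rcases hmc with rfl | rfl | rfl <;> dsimp only <;> omega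
  · rw [if_neg hmeet] at hmc hn
    simp only [List.mem_cons, List.not_mem_nil, or_false] at hmc
    rcases hmc with rfl | rfl | rfl <;> dsimp only <;> omega

/-- `xlEntry` is small for `i ≤ 5`. -/
theorem Small_xlEntry (π : CProf) (i : ℕ) (hi : i ≤ 5) : Small (xlEntry π i) := by
  intro mc hmc _
  unfold xlEntry at hmc
  by_cases h : 2 < i + 2
  · rw [if_pos h] at hmc
    simp only [List.mem_cons, List.not_mem_nil, or_false] at hmc
    rcases hmc with rfl | rfl <;> dsimp only <;> omega
  · rw [if_neg h] at hmc
    simp only [List.mem_cons, List.not_mem_nil, or_false] at hmc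
    obtain rfl := hmc
    dsimp only
    omega

end PL

end PercRepro.SixFour
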